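import Summits.QuantumFields.BalabanUV.T4Continuum.Support.DirichletCutoutVertices
import Summits.QuantumFields.BalabanUV.T4Continuum.Support.DirichletTubeEnergy
import Summits.QuantumFields.BalabanUV.T4Continuum.Support.DirichletTubeSum

/-!
# `BalabanUV.T4Continuum.Support.DirichletCutoutEdges` — NE2 (node U1a) formalisation swarm, sub-row `T4-U1a.S-NE2-D1-DIRICHLET°`, supplier item
# «Δ1-TUBES» (file T5): THE COVER IN `d + 1 = 4` DIMENSIONS — a site of a corner bundle `NC ρ β κ₁ κ₂` of a valid corner index (axes `μ, κ₁, κ₂`,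
# fourth axis `λ`) lies EITHER within `3K + 1` of an active VERTEX (when its `λ`-coordinate is within `3K` of a `λ`-face of `β`), OR — sliced
# along `λ` — on the PLATEAU of a tube of the family of file T4 with its transversal coordinates within `ρ + 1` of an active transversal vertex of
# the SLICED block set (file 17 on the transversal 3-torus, file T1's junction)
# (unit b2b-balaban-t4-ne2-formalise-leaf-08, gen 7, file T5)

HONEST FRAMING.  Lattice geometry at MODEL level (finite torus, `d + 1 = 4`); [folklore]; NE2 (U1a) is NOT proved by this file; spine PROVED 0/9
unchanged; NOT infinite volume, NOT the mass gap, NOT Clay.  HONEST DEPENDENCY (verbatim): «continuum YM on T⁴ ⇐ BetaPertH ∧ nine spine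
estimates (0/9 proved); BetaPertH ⇐ (D1) ∧ (D4) ∧ CAP+tail; G-an2-4 gates asym, D1 and NE2/3/4.»

WHAT THIS FILE PROVES (0 sorry; files 10, 17, T1 BY NAME).  `nearPlaneR_mono`, `exists_fourth` (pigeonhole on four axes), the transports
`nearPlaneR_ins_iff` ∕ `nearFaceR_ins_iff`, the block algebra `removeNth_sub_unitVec` ∕ `insertNth_removeNth_sub`, `botExp_slice`,
`apply_eq_cast_block_offs`, `mem_plateau_of_offs`, and the END **`cover_of_NC`**.

ABSOLUTE RULE (cell, verbatim): «No internally-minted statement may enter as a cited fact. Every hypothesis is either kernel-proved in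
this package or a verbatim quotation of a PUBLISHED theorem with page reference. The manuscript(s) under audit are NOT citable for
their own disputed steps — they are the thing under adjudication; programme-internal (2001/route/tribunal) claims are never citable.»
[folklore]; no definition; no `def … : Prop` fact.  NOT CLAIMED: any estimate, NE2, NE3.
-/

noncomputable section

open scoped BigOperators
open Finset

namespace Summit.QuantumFields.BalabanUV.T4Continuum.DirichletCutoutEdges

open Literature.MathematicalPhysics.QuantumFieldTheory.Balaban1983to89.B5Prop11Plancherel (Tor fine unitVec)
open Literature.MathematicalPhysics.QuantumFieldTheory.Balaban1983to89.B5Block118 (bpt)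
open Literature.MathematicalPhysics.QuantumFieldTheory.Balaban1983to89.B5Blocks16 (blockOf bpt_eq_natCast)
open Summit.QuantumFields.BalabanUV.T4Continuum.DirichletMonotoneCutoff (offsF bpt_blockOf_offsF)
open Summit.QuantumFields.BalabanUV.T4Continuum.DirichletMorreyDecayBlock (cornerBlock)
open Summit.QuantumFields.BalabanUV.T4Continuum.DirichletDipCutoff (BotExp)
open Summit.QuantumFields.BalabanUV.T4Continuum.DirichletCornerCutoutEta (CornerIdx)
open Summit.QuantumFields.BalabanUV.T4Continuum.DirichletCornerCutoutCover (NearPlaneR NearFaceR InWinR NC nearFaceR_mono)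
open Summit.QuantumFields.BalabanUV.T4Continuum.DirichletVertexCubes (NearVtx)
open Summit.QuantumFields.BalabanUV.T4Continuum.DirichletCutoutVertices (vtxOf ActV nearVtx_vtxOf vtxOf_mem_ActV)
open Summit.QuantumFields.BalabanUV.T4Continuum.TorusSlicing (ins)
open Summit.QuantumFields.BalabanUV.T4Continuum.LongitudinalRamp (lchart)
open Summit.QuantumFields.BalabanUV.T4Continuum.DirichletTubeBlock
  (Msl Ssl blockOf_ins_succAbove offsF_ins_succAbove ins_removeNth)
open Summit.QuantumFields.BalabanUV.T4Continuum.DirichletTubeEnergy (plateau)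
open Summit.QuantumFields.BalabanUV.T4Continuum.DirichletTubeSum (t0)

variable {d : ℕ} {n : ℕ} [NeZero n]

/-! ## §0 Small tools -/

/-- monotonicity of `NearPlaneR` in the radius. [folklore] -/
theorem nearPlaneR_mono {M : Fin d → ℕ} [∀ μ, NeZero (M μ)] {μ : Fin d} {ρ ρ' : ℕ} (hρ : ρ ≤ ρ') {β : Tor M} {x : Tor (fine n M)}
    (h : NearPlaneR n M μ ρ β x) : NearPlaneR n M μ ρ' β x := by
  rcases h with ⟨hb, ho⟩ | ⟨hb, ho⟩
  · exact Or.inl ⟨hb, ho.trans hρ⟩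
  · exact Or.inr ⟨hb, ho.trans hρ⟩

omit [NeZero n] in
/-- **pigeonhole on four axes**: three pairwise distinct axes leave exactly one. [folklore] -/
theorem exists_fourth (hd : d = 3) {μ κ₁ κ₂ : Fin (d + 1)} (h₁ : κ₁ ≠ μ) (h₂ : κ₂ ≠ μ) (h₁₂ : κ₁ ≠ κ₂) :
    ∃ lam : Fin (d + 1), lam ≠ μ ∧ lam ≠ κ₁ ∧ lam ≠ κ₂ ∧ ∀ ν : Fin (d + 1), ν ≠ μ → ν ≠ lam → (ν = κ₁ ∨ ν = κ₂) := by
  subst hd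
  revert μ κ₁ κ₂
  decide

/-! ## §1 Transport of the corner predicates along the slicing -/

section Transport

variable {M : Fin (d + 1) → ℕ} [hM : ∀ μ, NeZero (M μ)] (lam : Fin (d + 1))

/-- `NearPlaneR` along a transversal axis, read on the slice. [folklore] -/
theorem nearPlaneR_ins_iff (μ' : Fin d) (ρ : ℕ) (β : Tor M) (t : ZMod (fine n M lam)) (y : Tor (fine n (Msl M lam))) :
    NearPlaneR n M (lam.succAbove μ') ρ β (ins (fine n M) lam t y) ↔ NearPlaneR n (Msl M lam) μ' ρ (Fin.removeNth lam β) y := by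
  simp only [NearPlaneR, blockOf_ins_succAbove, offsF_ins_succAbove, Fin.removeNth]

/-- `NearFaceR` along a transversal axis, read on the slice. [folklore] -/
theorem nearFaceR_ins_iff (i : Fin d) (ρ : ℕ) (β : Tor M) (t : ZMod (fine n M lam)) (y : Tor (fine n (Msl M lam))) :
    NearFaceR n M ρ β (lam.succAbove i) (ins (fine n M) lam t y) ↔ NearFaceR n (Msl M lam) ρ (Fin.removeNth lam β) i y := by
  simp only [NearFaceR, blockOf_ins_succAbove, offsF_ins_succAbove, Fin.removeNth]

omit [NeZero n] hM in
/-- removing the `λ`-coordinate of `β − e_{succAbove i}`. [folklore] -/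
theorem removeNth_sub_unitVec (β : Tor M) (i : Fin d) :
    Fin.removeNth lam (β - unitVec M (lam.succAbove i)) = Fin.removeNth lam β - unitVec (Msl M lam) i := by
  funext j
  simp only [Fin.removeNth, Pi.sub_apply, unitVec]
  by_cases h : j = i
  · subst h; rw [Pi.single_eq_same, Pi.single_eq_same]
  · rw [Pi.single_eq_of_ne h, Pi.single_eq_of_ne (fun e => h (Fin.succAbove_right_injective e))]

omit [NeZero n] hM in
/-- `β − e_{succAbove i}` re-assembled from its `λ`-coordinate and its transversal part. [folklore] -/
theorem insertNth_removeNth_sub (β : Tor M) (i : Fin d) :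
    Fin.insertNth lam (β lam) (Fin.removeNth lam β - unitVec (Msl M lam) i) = β - unitVec M (lam.succAbove i) := by
  rw [← removeNth_sub_unitVec]
  have hl : (β - unitVec M (lam.succAbove i)) lam = β lam := by
    rw [Pi.sub_apply, unitVec, Pi.single_eq_of_ne (Fin.ne_succAbove lam i), sub_zero]
  conv_lhs => rw [← hl]
  exact Fin.insertNth_self_removeNth lam _

omit [NeZero n] hM in
/-- **a `−μ`-exposed block slices into a `−μ′`-exposed transversal block** of the sliced block set at its own `λ`-block. [folklore] -/
theorem botExp_slice (S : Tor M → Prop) {μ' : Fin d} {β : Tor M} (h : BotExp M S (lam.succAbove μ') β) :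
    BotExp (Msl M lam) (Ssl M lam S (β lam)) μ' (Fin.removeNth lam β) := by
  refine ⟨?_, ?_⟩
  · show S (Fin.insertNth lam (β lam) (Fin.removeNth lam β))
    rw [Fin.insertNth_self_removeNth]; exact h.1
  · show ¬ S (Fin.insertNth lam (β lam) (Fin.removeNth lam β - unitVec (Msl M lam) μ'))
    rw [insertNth_removeNth_sub]; exact h.2

/-- a coordinate of a site as the cast of `n·block + offset`. [folklore] -/
theorem apply_eq_cast_block_offs (x : Tor (fine n M)) (ν : Fin (d + 1)) :
    x ν = (((n * (blockOf n M x ν).val + (offsF n M x ν : ℕ)) : ℕ) : ZMod (fine n M ν)) := by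
  conv_lhs => rw [← bpt_blockOf_offsF n M x]
  exact bpt_eq_natCast n M _ _ ν

/-- **plateau membership from the offset**: `K − 1 ≤ o ≤ n − 3K − 1` (with `o = offsF x λ`, `4K = nn + 1 ≤ n`, `K ≥ 1`) puts `x λ` on the plateau of the
tube `q = (o + 1 − K)/(2K)` of its own `λ`-block, and `q < (n − 4K)/(2K) + 1`. [folklore] -/
theorem mem_plateau_of_offs {K nn : ℕ} (hK : 1 ≤ K) (hnn : 4 * K = nn + 1) (x : Tor (fine n M))
    (h1 : K - 1 ≤ (offsF n M x lam : ℕ)) (h2 : (offsF n M x lam : ℕ) + 3 * K + 1 ≤ n) :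
    ((offsF n M x lam : ℕ) + 1 - K) / (2 * K) < (n - 4 * K) / (2 * K) + 1
      ∧ x lam ∈ plateau n M lam K (nL := nn) (t0 n M lam K (blockOf n M x lam) (((offsF n M x lam : ℕ) + 1 - K) / (2 * K))) := by
  set o := (offsF n M x lam : ℕ) with ho
  set q := (o + 1 - K) / (2 * K) with hq
  have h2K : 0 < 2 * K := by omega
  have hq1 : 2 * K * q ≤ o + 1 - K := by rw [mul_comm]; exact Nat.div_mul_le_self _ _
  have hq2 : o + 1 - K < 2 * K * q + 2 * K := by
    have := Nat.lt_div_mul_add (a := o + 1 - K) h2K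
    rw [← hq] at this; linarith [mul_comm q (2 * K)]
  refine ⟨?_, ?_⟩
  · have : q ≤ (n - 4 * K) / (2 * K) := Nat.div_le_div_right (by omega)
    omega
  · rw [plateau, mem_image]
    have hs : o - 2 * K * q < nn + 1 := by omega
    refine ⟨⟨o - 2 * K * q, hs⟩, ?_, ?_⟩
    · rw [mem_filter]; refine ⟨mem_univ _, ?_, ?_⟩ <;> simp only <;> omega
    · rw [lchart, t0, apply_eq_cast_block_offs x lam, ← ho]
      show ((n * (blockOf n M x lam).val + 2 * K * q : ℕ) : ZMod (fine n M lam)) + ((o - 2 * K * q : ℕ) : ZMod (fine n M lam))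
        = ((n * (blockOf n M x lam).val + o : ℕ) : ZMod (fine n M lam))
      rw [← Nat.cast_add]
      congr 1
      omega

end Transport

/-! ## §2 THE COVER -/

section Cover

variable {M : Fin (d + 1) → ℕ} [hM : ∀ μ, NeZero (M μ)] {μ : Fin (d + 1)}

/-- **THE COVER OF A CORNER BUNDLE IN FOUR DIMENSIONS.**  `d + 1 = 4`, `1 ≤ K`, `4K = nn + 1 ≤ n`, `ρ ≤ 3K`; a valid corner index `(β, κ₁, κ₂)`
for the axis `μ` and a site `x` of its radius-`ρ` bundle.  Then EITHER `x` is within `3K + 1` of an active vertex, OR there is an axis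
`λ ≠ μ` such that `x λ` lies on the plateau of a tube `q < (n − 4K)/(2K) + 1` of the `λ`-block of `x` and the transversal part of `x` is within
`ρ + 1` of an active transversal vertex of the sliced block set. [folklore] -/
theorem cover_of_NC (hd : d = 3) (S : Tor M → Prop) [DecidablePred S] {ρ K nn : ℕ} (hK : 1 ≤ K) (hnn : 4 * K = nn + 1)
    (hρK : ρ ≤ 3 * K) {β : Tor M} {κ₁ κ₂ : Fin (d + 1)} {x : Tor (fine n M)} (hidx : CornerIdx M S μ β κ₁ κ₂)
    (hNC : NC n M μ ρ β κ₁ κ₂ x) :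
    (∃ β'' ∈ ActV M S, NearVtx n M (3 * K + 1) β'' x)
    ∨ (∃ lam : Fin (d + 1), lam ≠ μ ∧ ∃ q, q < (n - 4 * K) / (2 * K) + 1
        ∧ x lam ∈ plateau n M lam K (nL := nn) (t0 n M lam K (blockOf n M x lam) q)
        ∧ ∃ β' ∈ ActV (Msl M lam) (Ssl M lam S (blockOf n M x lam)), NearVtx n (Msl M lam) (ρ + 1) β' (Fin.removeNth lam x)) := by
  obtain ⟨hBE, h₁, h₂, h₁₂⟩ := hidx
  obtain ⟨lam, hlμ, hl1, hl2, hall4⟩ := exists_fourth hd h₁ h₂ h₁₂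
  obtain ⟨hP, hF1, hF2, hwin⟩ := hNC
  have hκ : ∀ ν, ν ≠ μ → ν ≠ lam → NearFaceR n M ρ β ν x := by
    intro ν hν hνl
    rcases hall4 ν hν hνl with rfl | rfl
    · exact hF1
    · exact hF2
  by_cases hT : blockOf n M x lam = β lam ∧ K - 1 ≤ (offsF n M x lam : ℕ) ∧ (offsF n M x lam : ℕ) + 3 * K + 1 ≤ n
  · -- the tube case
    right
    obtain ⟨hb, ho1, ho2⟩ := hT
    obtain ⟨hq, hmem⟩ := mem_plateau_of_offs lam hK hnn x ho1 ho2
    refine ⟨lam, hlμ, _, hq, hmem, ?_⟩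
    -- transversal data
    obtain ⟨μ', hμ'⟩ := Fin.exists_succAbove_eq hlμ.symm
    set y := Fin.removeNth lam x with hy
    have hx : ins (fine n M) lam (x lam) y = x := ins_removeNth n M lam x
    have hP3 : NearPlaneR n (Msl M lam) μ' ρ (Fin.removeNth lam β) y := by
      rw [← nearPlaneR_ins_iff lam μ' ρ β (x lam) y, hx, hμ']; exact hP
    have hall3 : ∀ ν', ν' ≠ μ' → NearFaceR n (Msl M lam) ρ (Fin.removeNth lam β) ν' y := by
      intro ν' hν'
      have hne : lam.succAbove ν' ≠ μ := by rw [← hμ']; exact fun e => hν' (Fin.succAbove_right_injective e)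
      rw [← nearFaceR_ins_iff lam ν' ρ β (x lam) y, hx]
      exact hκ _ hne (Fin.succAbove_ne lam ν')
    have hBE3 : BotExp (Msl M lam) (Ssl M lam S (β lam)) μ' (Fin.removeNth lam β) := botExp_slice lam S (by rw [hμ']; exact hBE)
    rw [hb]
    exact ⟨vtxOf n (Msl M lam) μ' ρ (Fin.removeNth lam β) y, vtxOf_mem_ActV _ hBE3 ρ y, nearVtx_vtxOf hP3 hall3⟩
  · -- the vertex case: `x` is within `3K` of a `λ`-face of `β`
    left
    have hFl : NearFaceR n M (3 * K) β lam x := by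
      rcases hwin lam hlμ with hb | hNF
      · left
        refine ⟨hb, ?_⟩
        by_cases h1 : K - 1 ≤ (offsF n M x lam : ℕ)
        · have hC : ¬ ((offsF n M x lam : ℕ) + 3 * K + 1 ≤ n) := fun hC => hT ⟨hb, h1, hC⟩
          right; omega
        · left; omega
      · exact nearFaceR_mono (by omega) hNF
    have hall : ∀ ν, ν ≠ μ → NearFaceR n M (3 * K) β ν x := by
      intro ν hν
      by_cases hνl : ν = lam
      · rw [hνl]; exact hFl
      · exact nearFaceR_mono hρK (hκ ν hν hνl)
    exact ⟨vtxOf n M μ (3 * K) β x, vtxOf_mem_ActV S hBE (3 * K) x, nearVtx_vtxOf (nearPlaneR_mono hρK hP) hall⟩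

end Cover

end Summit.QuantumFields.BalabanUV.T4Continuum.DirichletCutoutEdges

end
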